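import Summits.Parity.BatemanHorn.Theorems.SoloBlindSimpleImpostor
import HarnessLib

/-!
# The anti-diagonal threshold for parity-in-progressions information (solo-blind, session 4)

Continuation of `SoloBlindSimpleImpostor`.  Let `P` be a finite set of primes (on paper:
the primes in `(x^γ, x^{γ+η}]`), `g P n = #{p ∈ P : p ∣ n}`, `λ(n) = (−1)^{Ω(n)}` (`lam`).

1. `g_class_sum_twisted_general`: for EVERY modulus `d > 0` (coprime to `P` or not)
   `∑_{a<n≤b, d∣n} λ(n)·g P n = λ(d)·( #{p∈P : p∣d} · ∑_{a/d<k≤b/d} λ(k) − ∑_{p∈P, p∤d} ∑_{a/(pd)<k≤b/(pd)} λ(k) )`,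
   hence `|…| ≤ #{p∈P : p∣d}·|∑_{k≤…} λ| + ∑_{p∈P} |∑_{k≤…} λ|` (`…_abs_le`).  With the prime number
   theorem for `λ` on intervals (on paper) this shows that the impostor `κ⁻¹ g P` — whose PLAIN
   level of distribution is only `γ` — has TWISTED (Liouville / Möbius in progressions) level
   `1 − γ − η`: prime-free bounded sequences exist for every pair (plain level `ν`, twisted level `α`)
   with `ν < 1/2` and `α + ν < 1`.
2. `anti P κ t n = 1 + λ(n)·t·(1 − κ⁻¹ g P n)`: value `1 − t` at primes outside `P` (`anti_prime`),
   values in `[0,2]` when `0 ≤ t ≤ 1` and `t(κ⁻¹ g − 1) ≤ 1` (`anti_mem_Icc`), PLAIN class sums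
   `= #{d∣n} + tλ(d)∑λ − tκ⁻¹·(twisted class sum of g)` (`anti_class_sum`; so plain level `1 − γ − η`
   by item 1), TWISTED class sums `= λ(d)∑λ + t#{d∣n} − tκ⁻¹∑_{d∣n} g` (`anti_class_sum_twisted`,
   `_coprime`: exact for `d` coprime to `P`, so twisted level `γ`).  On paper: for plain level
   `ν ≥ 1/2` and twisted level `α < 1 − ν` such sequences have prime ratio `1 − t < 1`, so
   `R(ν) ∧ Hooley(α) ⇒ (S₁)` holds iff `α + ν > 1` (off the boundary line), answering the question on
   p. 1664 of K. Ford, *On Bombieri's asymptotic sieve*, TAMS 357 (2005), for every `ν < 1`.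

No analytic input is used here; everything is finite counting and algebra.
-/

noncomputable section

open Finset
open ArithmeticFunction
open scoped ArithmeticFunction.Omega

namespace Summit.Parity.BatemanHorn.Theorems.SoloBlindAntiDiagonal

open Summit.Parity.BatemanHorn.Theorems.SoloBlindParityImpostor (g g_eq_zero_of_prime)
open Summit.Parity.BatemanHorn.Theorems.SoloBlindSimpleImpostor

variable {P : Finset ℕ} {a b d n p : ℕ} {κ : ℝ}

/-- Bare Liouville class sum: `∑_{a<n≤b, d∣n} λ(n) = λ(d) · ∑_{a/d<k≤b/d} λ(k)`. -/
theorem lam_class_sum (hd : 0 < d) :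
    ∑ n ∈ (Ioc a b).filter (d ∣ ·), lam n = lam d * ∑ k ∈ Ioc (a / d) (b / d), lam k := by
  rw [sum_filter_dvd_Ioc hd, Finset.mul_sum]
  refine Finset.sum_congr rfl fun k hk => ?_
  rw [mem_Ioc] at hk
  have hk0 : k ≠ 0 := by
    intro h
    rw [h] at hk
    exact Nat.not_lt_zero _ hk.1
  rw [lam_mul hd.ne' hk0]

/-- `g` splits along any partition of `P` by a decidable predicate. -/
theorem g_split (P : Finset ℕ) (r : ℕ → Prop) [DecidablePred r] (n : ℕ) :
    (g P n : ℝ) = g (P.filter r) n + g (P.filter (fun p => ¬ r p)) n := by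
  rw [g_eq_sum_ite, g_eq_sum_ite, g_eq_sum_ite]
  exact (Finset.sum_filter_add_sum_filter_not P r _).symm

/-- If every member of `Q` divides `d` and `d ∣ n`, then `g Q n = #Q`. -/
theorem g_eq_card_of_forall_dvd {Q : Finset ℕ} (hQ : ∀ p ∈ Q, p ∣ d) (hdn : d ∣ n) :
    g Q n = #Q := by
  unfold g
  congr 1
  exact Finset.filter_true_of_mem fun p hp => (hQ p hp).trans hdn

/-- GENERAL-MODULUS TWISTED CLASS SUM. For a finite set `P` of primes and any `d > 0`:
`∑_{a<n≤b, d∣n} λ(n) g P n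
   = λ(d) · (#{p ∈ P : p ∣ d} · ∑_{a/d<k≤b/d} λ(k)) − λ(d) · ∑_{p∈P, p∤d} ∑_{a/(pd)<k≤b/(pd)} λ(k)`. -/
theorem g_class_sum_twisted_general (hd : 0 < d) (hP : ∀ p ∈ P, p.Prime) :
    ∑ n ∈ (Ioc a b).filter (d ∣ ·), lam n * (g P n : ℝ)
      = lam d * ((#(P.filter (· ∣ d)) : ℝ) * ∑ k ∈ Ioc (a / d) (b / d), lam k)
        - lam d * ∑ p ∈ P.filter (fun p => ¬ p ∣ d),
            ∑ k ∈ Ioc (a / (p * d)) (b / (p * d)), lam k := by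
  have hsplit : ∀ n ∈ (Ioc a b).filter (d ∣ ·),
      lam n * (g P n : ℝ) = lam n * (#(P.filter (· ∣ d)) : ℝ)
        + lam n * (g (P.filter (fun p => ¬ p ∣ d)) n : ℝ) := by
    intro n hn
    have hdn : d ∣ n := (Finset.mem_filter.1 hn).2
    rw [g_split P (· ∣ d) n, mul_add,
      g_eq_card_of_forall_dvd (Q := P.filter (· ∣ d)) (fun p hp => (Finset.mem_filter.1 hp).2) hdn]
  rw [Finset.sum_congr rfl hsplit, Finset.sum_add_distrib]
  have h1 : ∑ n ∈ (Ioc a b).filter (d ∣ ·), lam n * (#(P.filter (· ∣ d)) : ℝ)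
      = lam d * ((#(P.filter (· ∣ d)) : ℝ) * ∑ k ∈ Ioc (a / d) (b / d), lam k) := by
    rw [← Finset.sum_mul, lam_class_sum hd]
    ring
  have hP' : ∀ p ∈ P.filter (fun p => ¬ p ∣ d), p.Prime ∧ Nat.Coprime p d := by
    intro p hp
    obtain ⟨hpP, hnd⟩ := Finset.mem_filter.1 hp
    exact ⟨hP p hpP, (Nat.Prime.coprime_iff_not_dvd (hP p hpP)).2 hnd⟩
  rw [h1, g_class_sum_twisted hd hP']
  ring

/-- The general twisted class sum is bounded by Liouville sums over intervals:
`|∑_{a<n≤b, d∣n} λ(n) g P n| ≤ #{p∈P : p∣d}·|∑_{a/d<k≤b/d} λ(k)| + ∑_{p∈P} |∑_{a/(pd)<k≤b/(pd)} λ(k)|`. -/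
theorem g_class_sum_twisted_general_abs_le (hd : 0 < d) (hP : ∀ p ∈ P, p.Prime) :
    |∑ n ∈ (Ioc a b).filter (d ∣ ·), lam n * (g P n : ℝ)|
      ≤ (#(P.filter (· ∣ d)) : ℝ) * |∑ k ∈ Ioc (a / d) (b / d), lam k|
        + ∑ p ∈ P, |∑ k ∈ Ioc (a / (p * d)) (b / (p * d)), lam k| := by
  rw [g_class_sum_twisted_general hd hP]
  have hω : (0 : ℝ) ≤ #(P.filter (· ∣ d)) := Nat.cast_nonneg _
  calc |lam d * ((#(P.filter (· ∣ d)) : ℝ) * ∑ k ∈ Ioc (a / d) (b / d), lam k)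
          - lam d * ∑ p ∈ P.filter (fun p => ¬ p ∣ d),
              ∑ k ∈ Ioc (a / (p * d)) (b / (p * d)), lam k|
        ≤ |lam d * ((#(P.filter (· ∣ d)) : ℝ) * ∑ k ∈ Ioc (a / d) (b / d), lam k)|
          + |lam d * ∑ p ∈ P.filter (fun p => ¬ p ∣ d),
              ∑ k ∈ Ioc (a / (p * d)) (b / (p * d)), lam k| := abs_sub _ _
    _ = (#(P.filter (· ∣ d)) : ℝ) * |∑ k ∈ Ioc (a / d) (b / d), lam k|
          + |∑ p ∈ P.filter (fun p => ¬ p ∣ d),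
              ∑ k ∈ Ioc (a / (p * d)) (b / (p * d)), lam k| := by
          rw [abs_mul, abs_mul, abs_mul, abs_lam, one_mul, one_mul, abs_of_nonneg hω]
    _ ≤ (#(P.filter (· ∣ d)) : ℝ) * |∑ k ∈ Ioc (a / d) (b / d), lam k|
          + ∑ p ∈ P.filter (fun p => ¬ p ∣ d),
              |∑ k ∈ Ioc (a / (p * d)) (b / (p * d)), lam k| := by
          gcongr
          exact Finset.abs_sum_le_sum_abs _ _
    _ ≤ (#(P.filter (· ∣ d)) : ℝ) * |∑ k ∈ Ioc (a / d) (b / d), lam k|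
          + ∑ p ∈ P, |∑ k ∈ Ioc (a / (p * d)) (b / (p * d)), lam k| := by
          gcongr
          exact Finset.filter_subset _ _

/-! ## The anti-diagonal sequence `1 + λ·t·(1 − κ⁻¹ g)` -/

/-- The anti-diagonal sequence: `anti P κ t n = 1 + λ(n) · t · (1 − κ⁻¹ g P n)`. -/
def anti (P : Finset ℕ) (κ t : ℝ) (n : ℕ) : ℝ := 1 + lam n * (t * (1 - κ⁻¹ * (g P n : ℝ)))

/-- At a prime outside `P` (with `1 ∉ P`) the anti-diagonal sequence takes the value `1 − t`. -/
theorem anti_prime {t : ℝ} (hp : p.Prime) (hP : ∀ q ∈ P, q ≠ 1 ∧ q ≠ p) :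
    anti P κ t p = 1 - t := by
  unfold anti
  rw [g_eq_zero_of_prime hp hP, lam_prime hp]
  push_cast
  ring

/-- Values in `[0, 2]`: if `0 ≤ κ`, `0 ≤ t ≤ 1` and `t · (κ⁻¹ g P n − 1) ≤ 1`, then `0 ≤ anti ≤ 2`. -/
theorem anti_mem_Icc {t : ℝ} (hκ : 0 ≤ κ) (ht0 : 0 ≤ t) (ht1 : t ≤ 1)
    (hG : t * (κ⁻¹ * (g P n : ℝ) - 1) ≤ 1) :
    0 ≤ anti P κ t n ∧ anti P κ t n ≤ 2 := by
  unfold anti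
  have hg0 : 0 ≤ κ⁻¹ * (g P n : ℝ) := mul_nonneg (inv_nonneg.mpr hκ) (Nat.cast_nonneg _)
  have hy1 : t * (1 - κ⁻¹ * (g P n : ℝ)) ≤ 1 := by
    have : t * (1 - κ⁻¹ * (g P n : ℝ)) ≤ t * 1 :=
      mul_le_mul_of_nonneg_left (by linarith) ht0
    linarith
  have hy2 : -1 ≤ t * (1 - κ⁻¹ * (g P n : ℝ)) := by
    have : t * (1 - κ⁻¹ * (g P n : ℝ)) = - (t * (κ⁻¹ * (g P n : ℝ) - 1)) := by ring
    linarith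
  have hly : |lam n * (t * (1 - κ⁻¹ * (g P n : ℝ)))| ≤ 1 := by
    rw [abs_mul, abs_lam, one_mul]
    exact abs_le.2 ⟨hy2, hy1⟩
  constructor
  · linarith [(abs_le.1 hly).1]
  · linarith [(abs_le.1 hly).2]

/-- PLAIN class sum of the anti-diagonal sequence:
`∑_{d∣n} anti = #{a<n≤b : d∣n} + t·λ(d)·∑_{a/d<k≤b/d} λ(k) − t·κ⁻¹·∑_{d∣n} λ(n) g P n`
(the last sum is evaluated by `g_class_sum_twisted_general`). -/
theorem anti_class_sum {t : ℝ} (hd : 0 < d) :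
    ∑ n ∈ (Ioc a b).filter (d ∣ ·), anti P κ t n
      = (#((Ioc a b).filter (d ∣ ·)) : ℝ) + t * (lam d * ∑ k ∈ Ioc (a / d) (b / d), lam k)
        - t * κ⁻¹ * ∑ n ∈ (Ioc a b).filter (d ∣ ·), lam n * (g P n : ℝ) := by
  have hpt : ∀ n, anti P κ t n = 1 + (t * lam n - t * κ⁻¹ * (lam n * (g P n : ℝ))) := by
    intro n
    unfold anti
    ring
  simp_rw [hpt]
  rw [Finset.sum_add_distrib, Finset.sum_const, nsmul_eq_mul, mul_one, Finset.sum_sub_distrib,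
    ← Finset.mul_sum, ← Finset.mul_sum, lam_class_sum hd]
  ring

/-- TWISTED class sum of the anti-diagonal sequence (using `λ² = 1`):
`∑_{d∣n} λ(n)·anti = λ(d)·∑_{a/d<k≤b/d} λ(k) + t·#{a<n≤b : d∣n} − t·κ⁻¹·∑_{d∣n} g P n`
(the last sum is exact for `d` coprime to the members of `P`, by `g_class_sum`). -/
theorem anti_class_sum_twisted {t : ℝ} (hd : 0 < d) :
    ∑ n ∈ (Ioc a b).filter (d ∣ ·), lam n * anti P κ t n
      = lam d * ∑ k ∈ Ioc (a / d) (b / d), lam k + t * (#((Ioc a b).filter (d ∣ ·)) : ℝ)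
        - t * κ⁻¹ * ∑ n ∈ (Ioc a b).filter (d ∣ ·), (g P n : ℝ) := by
  have hsq : ∀ n, lam n * lam n = 1 := by
    intro n
    unfold lam
    rw [← pow_add, ← two_mul, pow_mul]
    norm_num
  have hpt : ∀ n, lam n * anti P κ t n = lam n + (t - t * κ⁻¹ * (g P n : ℝ)) := by
    intro n
    unfold anti
    have h := hsq n
    calc lam n * (1 + lam n * (t * (1 - κ⁻¹ * (g P n : ℝ))))
          = lam n + lam n * lam n * (t * (1 - κ⁻¹ * (g P n : ℝ))) := by ring
      _ = lam n + (t - t * κ⁻¹ * (g P n : ℝ)) := by rw [h]; ring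
  simp_rw [hpt]
  rw [Finset.sum_add_distrib, lam_class_sum hd, Finset.sum_sub_distrib, Finset.sum_const,
    nsmul_eq_mul, ← Finset.mul_sum]
  ring

/-- TWISTED class sum of `anti` at a modulus coprime to `P`, with the main terms displayed:
`∑_{d∣n} λ(n)·anti − λ(d)·∑_k λ(k) = t·(⌊b/d⌋ − ⌊a/d⌋) − t·κ⁻¹·∑_{p∈P}(⌊b/(pd)⌋ − ⌊a/(pd)⌋)`. -/
theorem anti_class_sum_twisted_coprime {t : ℝ} (hd : 0 < d)
    (hP : ∀ p ∈ P, 0 < p ∧ Nat.Coprime p d) :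
    ∑ n ∈ (Ioc a b).filter (d ∣ ·), lam n * anti P κ t n
        - lam d * ∑ k ∈ Ioc (a / d) (b / d), lam k
      = t * ((b / d - a / d : ℕ) : ℝ)
        - t * κ⁻¹ * ∑ p ∈ P, ((b / (p * d) - a / (p * d) : ℕ) : ℝ) := by
  rw [anti_class_sum_twisted hd, g_class_sum hd hP, card_filter_dvd_Ioc hd]
  ring

end Summit.Parity.BatemanHorn.Theorems.SoloBlindAntiDiagonal

end
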